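import Literature.Barriers.CriticalPhenomena.TimarLemma42
import HarnessLib

/-!
# Timár 2006, proof of Thm. 4.3: boxes, sealed box components, children, regions and the
# mass process — the definitions and the key disjointness, PROVED

Barrier catalogue `Literature/Barriers/CriticalPhenomena/`; a brick of the proof of the named
fact `Timar2006_noInfiniteLightClusters` (`TimarCriticalNonunimodular.lean`; Á. Timár, Ann.
Probab. 34 (2006) 2344–2364, Thm. 4.3, proof pp. 2353–2356). The printed proof grows, inside a
Bernoulli(`p̃`) configuration with `p̃ < p_c`, a branching process whose offspring are read off
from the open component of `x` in the box "`B_x(i; r) := B(x, r) ∩ G′(x) ∩ G(ℓ_{j+i}, ℓ_j]`",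
required to be *good*: "at least `k` vertices in `G(ℓ_{j+i}, ℓ_{j+i−1}]` and the side boundary
of `B_x(i; r)` is disjoint from `C`" (p. 2354). This file fixes ALL the definitions of the formal
proof (so that the later bricks `TimarBoxes*.lean`, `TimarCriticalNonunimodularProofs.lean` only
add theorems) and proves the combinatorial heart:

* `timarBox G o x ρ β = {x} ∪ {v ∈ B(x, ρ) : β < w(v) ≤ Δ w(x)}` (`Δ = minNbrWeight`, weights
  `w = autWeight G o`): `B(x, ρ) ∩ G′(x)` above the absolute bottom `β`, with ALL long edges from
  `x` (a choice-free, automorphism-covariant `G′(x)`); `timarBoxGraph`, `timarBoxCluster`;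
* `TimarSealed` — our reading of "the side boundary is disjoint from `C`": every OPEN edge from a
  vertex `v ≠ x` of the component to a vertex of weight `> β` stays in the box (what niceness
  `C(x) = C(x)|G′(x)` and "`C ∩ G(ℓ_{j+i}, ℓ_j]` is finite" give, p. 2354; the printed graph-
  theoretic side boundary is a.s. met by a nice cluster spreading on `ℓ_1(x)`, and its ball-only
  reading does not give disjointness). Monotone in `β` (`TimarSealed.mono`), and it yields the KEY
  DISJOINTNESS of p. 2355 for ANY two distinct vertices of one slab, with no "parental" selection
  (`timarBoxCluster_disjoint`, `timarChildren_disjoint`);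
* `timarChildren` (children of a generation-`b` vertex: its sealed component, bottom
  `Δ^{b+n+3}`, met with the lowest slab `b+n+2` of the box), `timarGood` (the local `x`-RELATIVE
  event bounding offspring from below uniformly in the position of `x` in its slab — the "uniform
  choice" of p. 2354), `timarRegion` (the edges a generation reads: pairwise disjoint weight
  windows), `timarMass`/`timarPop` (the generations of `T`, weighted so that the population is a
  martingale — our replacement for the thinning "exactly `k` children with probability `p`" of
  the proof of Lemma 4.1).

## References

* Á. Timár, Ann. Probab. 34 (2006) 2344–2364 (arXiv:math/0702875), §4: proof of Thm. 4.3
  (pp. 2353–2356) and of Lemma 4.1 (p. 2352). [Timar2006]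
-/

noncomputable section

namespace Literature.Barriers.CriticalPhenomena

open Literature.Probability.Percolation
open scoped _root_.ENNReal

variable {V : Type*}

/-! ### Boxes -/

/-- The **box** of `x` with radius `ρ` and bottom `β`: `x` together with the vertices of the ball
`B(x, ρ)` whose weight lies in `(β, Δ·w(x)]` — the vertex set of `B(x, ρ) ∩ G′(x)` above the
weight `β` (`G′(x)` = `x`, its long edges, and the levels `ℓ_1(x)` and below).
[cite: Timar2006, §4 (proof of Thm. 4.3: G′(x) and B_x(i; r))] -/
def timarBox (G : SimpleGraph V) [G.LocallyFinite] (o x : V) (ρ : ℕ) (β : ℝ≥0∞) : Set V :=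
  insert x {v | v ∈ graphBall G x ρ ∧ β < autWeight G o v ∧
    autWeight G o v ≤ minNbrWeight G o * autWeight G o x}

/-- The steps of `G` inside the box (all long edges from `x` included).
[cite: Timar2006, §4 (proof of Thm. 4.3: B_x(i; r) as a subgraph of G′(x))] -/
def timarBoxGraph (G : SimpleGraph V) [G.LocallyFinite] (o x : V) (ρ : ℕ) (β : ℝ≥0∞) :
    SimpleGraph V :=
  withinGraph G (timarBox G o x ρ β)

/-- "The open component of `x` in `B_x(i; r)`". [cite: Timar2006, §4 (proof of Thm. 4.3)] -/
def timarBoxCluster (G : SimpleGraph V) [G.LocallyFinite] (o x : V) (ρ : ℕ) (β : ℝ≥0∞)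
    (ω : BondConfig V) : Set V :=
  openClusterIn (timarBoxGraph G o x ρ β) ω x

/-- The box component is **sealed**: every open edge from one of its vertices other than `x` to
a vertex of weight `> β` stays inside the box (our reading of "the side boundary of `B_x(i; r)`
is disjoint from `C`", see the module docstring).
[cite: Timar2006, §4 (proof of Thm. 4.3: good components, second property)] -/
def TimarSealed (G : SimpleGraph V) [G.LocallyFinite] (o x : V) (ρ : ℕ) (β : ℝ≥0∞)
    (ω : BondConfig V) : Prop :=
  ∀ ⦃v : V⦄, v ∈ timarBoxCluster G o x ρ β ω → v ≠ x → ∀ ⦃u : V⦄, G.Adj v u → s(v, u) ∈ ω →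
    β < autWeight G o u → u ∈ timarBox G o x ρ β

section Box

variable {G : SimpleGraph V} [G.LocallyFinite] {o : V}

/-- Membership in a box, unfolded. [folklore] -/
theorem mem_timarBox_iff {x : V} {ρ : ℕ} {β : ℝ≥0∞} {v : V} :
    v ∈ timarBox G o x ρ β ↔ v = x ∨ (v ∈ graphBall G x ρ ∧ β < autWeight G o v ∧
      autWeight G o v ≤ minNbrWeight G o * autWeight G o x) :=
  Iff.rfl

/-- `x` lies in its box. [folklore] -/
theorem self_mem_timarBox (x : V) (ρ : ℕ) (β : ℝ≥0∞) : x ∈ timarBox G o x ρ β :=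
  Set.mem_insert x _

/-- A box lies inside the ball `B(x, ρ)`. [folklore] -/
theorem timarBox_subset_graphBall (x : V) (ρ : ℕ) (β : ℝ≥0∞) :
    timarBox G o x ρ β ⊆ graphBall G x ρ := by
  rintro v (rfl | ⟨hv, -, -⟩)
  · exact mem_graphBall_self G _ ρ
  · exact hv

/-- Boxes are finite. [folklore] -/
theorem timarBox_finite (x : V) (ρ : ℕ) (β : ℝ≥0∞) : (timarBox G o x ρ β).Finite :=
  (graphBall_finite G x ρ).subset (timarBox_subset_graphBall x ρ β)

/-- A vertex of the box other than `x` has weight in `(β, Δ w(x)]`. [folklore] -/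
theorem weight_of_mem_timarBox {x : V} {ρ : ℕ} {β : ℝ≥0∞} {v : V} (hv : v ∈ timarBox G o x ρ β)
    (hvx : v ≠ x) : β < autWeight G o v ∧ autWeight G o v ≤ minNbrWeight G o * autWeight G o x := by
  rcases hv with rfl | ⟨-, h1, h2⟩
  · exact absurd rfl hvx
  · exact ⟨h1, h2⟩

/-- Boxes grow when the radius grows and the bottom sinks. [folklore] -/
theorem timarBox_mono (x : V) {ρ₁ ρ₂ : ℕ} (hρ : ρ₁ ≤ ρ₂) {β₁ β₂ : ℝ≥0∞} (hβ : β₂ ≤ β₁) :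
    timarBox G o x ρ₁ β₁ ⊆ timarBox G o x ρ₂ β₂ := by
  rintro v (rfl | ⟨hv, h1, h2⟩)
  · exact self_mem_timarBox _ _ _
  · exact Or.inr ⟨graphBall_mono G x hρ hv, lt_of_le_of_lt hβ h1, h2⟩

/-- The box graphs grow likewise. [folklore] -/
theorem timarBoxGraph_mono (x : V) {ρ₁ ρ₂ : ℕ} (hρ : ρ₁ ≤ ρ₂) {β₁ β₂ : ℝ≥0∞} (hβ : β₂ ≤ β₁) :
    timarBoxGraph G o x ρ₁ β₁ ≤ timarBoxGraph G o x ρ₂ β₂ :=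
  withinGraph_mono G (timarBox_mono x hρ hβ)

/-- `x` lies in its box component. [folklore] -/
theorem self_mem_timarBoxCluster (x : V) (ρ : ℕ) (β : ℝ≥0∞) (ω : BondConfig V) :
    x ∈ timarBoxCluster G o x ρ β ω :=
  self_mem_openClusterIn _ ω x

/-- The box component lies in the box. [folklore] -/
theorem timarBoxCluster_subset_timarBox (x : V) (ρ : ℕ) (β : ℝ≥0∞) (ω : BondConfig V) :
    timarBoxCluster G o x ρ β ω ⊆ timarBox G o x ρ β :=
  openClusterIn_withinGraph_subset (self_mem_timarBox x ρ β) ω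

/-- The box component lies in the open cluster of `x`. [folklore] -/
theorem timarBoxCluster_subset_openCluster (x : V) (ρ : ℕ) (β : ℝ≥0∞) (ω : BondConfig V) :
    timarBoxCluster G o x ρ β ω ⊆ openCluster ω x :=
  openClusterIn_subset_openCluster _ ω x

/-- Box components grow with the box. [folklore] -/
theorem timarBoxCluster_mono (x : V) {ρ₁ ρ₂ : ℕ} (hρ : ρ₁ ≤ ρ₂) {β₁ β₂ : ℝ≥0∞} (hβ : β₂ ≤ β₁)
    (ω : BondConfig V) : timarBoxCluster G o x ρ₁ β₁ ω ⊆ timarBoxCluster G o x ρ₂ β₂ ω :=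
  openClusterIn_mono_graph (timarBoxGraph_mono x hρ hβ) ω x

/-- The box component is finite. [folklore] -/
theorem timarBoxCluster_finite (x : V) (ρ : ℕ) (β : ℝ≥0∞) (ω : BondConfig V) :
    (timarBoxCluster G o x ρ β ω).Finite :=
  (timarBox_finite x ρ β).subset (timarBoxCluster_subset_timarBox x ρ β ω)

/-- One open step of `G` inside the box extends the box component. [folklore] -/
theorem mem_timarBoxCluster_of_adj {x : V} {ρ : ℕ} {β : ℝ≥0∞} {ω : BondConfig V} {v u : V}
    (hv : v ∈ timarBoxCluster G o x ρ β ω) (hadj : G.Adj v u) (hopen : s(v, u) ∈ ω)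
    (hu : u ∈ timarBox G o x ρ β) : u ∈ timarBoxCluster G o x ρ β ω :=
  mem_openClusterIn_of_adj hv ⟨hadj, timarBoxCluster_subset_timarBox x ρ β ω hv, hu⟩ hopen

/-! ### Sealed components: monotonicity in the bottom, and the key disjointness -/

/-- **Sealing is monotone in the bottom**: a component sealed above the bottom `β₁` is sealed
above every higher bottom `β₂ ≥ β₁` (same radius). [folklore] -/
theorem TimarSealed.mono {x : V} {ρ : ℕ} {β₁ β₂ : ℝ≥0∞} (hβ : β₁ ≤ β₂) {ω : BondConfig V}
    (h : TimarSealed G o x ρ β₁ ω) : TimarSealed G o x ρ β₂ ω := by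
  intro v hv hvx u hadj hopen hβu
  have hv₁ : v ∈ timarBoxCluster G o x ρ β₁ ω := timarBoxCluster_mono x le_rfl hβ ω hv
  have hu := h hv₁ hvx hadj hopen (lt_of_le_of_lt hβ hβu)
  rcases hu with rfl | ⟨hball, -, hle⟩
  · exact self_mem_timarBox _ _ _
  · exact Or.inr ⟨hball, hβu, hle⟩

/-- A vertex `x` does not lie in the box of another vertex `y` unless it is at least one long
edge below `y`: if `Δ w(y) < w(x)` and `x ≠ y` then `x ∉ timarBox y`. [folklore] -/
theorem not_mem_timarBox_of_lt {x y : V} (hxy : x ≠ y)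
    (hlt : minNbrWeight G o * autWeight G o y < autWeight G o x) (ρ : ℕ) (β : ℝ≥0∞) :
    x ∉ timarBox G o y ρ β := by
  rintro (h | ⟨-, -, hle⟩)
  · exact hxy h
  · exact absurd hle (not_le.2 hlt)

/-- **The sealed component of `x` swallows every open box-`y` step it touches**: if the box
component of `x` (bottom `β`) is sealed, `x ∉` box of `y` and `β < w(y)`, then an open step of
the box graph of `y` starting in the component of `x` ends in it.
[cite: Timar2006, §4 (proof of Thm. 4.3: "there exists an open path between x and y within B_x ∪ B_y")] -/
theorem mem_timarBoxCluster_of_boxGraph_adj {x y : V} {ρ ρ' : ℕ} {β : ℝ≥0∞} {ω : BondConfig V}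
    (hseal : TimarSealed G o x ρ β ω) (hx : x ∉ timarBox G o y ρ' β) (hy : β < autWeight G o y)
    {a b : V} (hab : (openGraph ω ⊓ timarBoxGraph G o y ρ' β).Adj a b)
    (ha : a ∈ timarBoxCluster G o x ρ β ω) : b ∈ timarBoxCluster G o x ρ β ω := by
  rw [SimpleGraph.inf_adj, openGraph_adj] at hab
  obtain ⟨⟨hopen, -⟩, hG, haB, hbB⟩ := hab
  have hax : a ≠ x := fun h => hx (h ▸ haB)
  have hβb : β < autWeight G o b := by
    rcases hbB with rfl | ⟨-, h, -⟩
    · exact hy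
    · exact h
  exact mem_timarBoxCluster_of_adj ha hG hopen (hseal ha hax hG hopen hβb)

/-- Walk form of the previous lemma: an open box-`y` walk starting in the sealed component of
`x` stays in it. [cite: Timar2006, §4 (proof of Thm. 4.3: disjointness of good components)] -/
theorem mem_timarBoxCluster_of_boxGraph_walk {x y : V} {ρ ρ' : ℕ} {β : ℝ≥0∞} {ω : BondConfig V}
    (hseal : TimarSealed G o x ρ β ω) (hx : x ∉ timarBox G o y ρ' β) (hy : β < autWeight G o y) :
    ∀ {a b : V} (_ : (openGraph ω ⊓ timarBoxGraph G o y ρ' β).Walk a b),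
      a ∈ timarBoxCluster G o x ρ β ω → b ∈ timarBoxCluster G o x ρ β ω
  | _, _, .nil, ha => ha
  | _, _, .cons hadj p, ha =>
    mem_timarBoxCluster_of_boxGraph_walk hseal hx hy p
      (mem_timarBoxCluster_of_boxGraph_adj hseal hx hy hadj ha)

/-- **Key disjointness** ("if the open components of `x` in `B_x` and `y` in `B_y` are good, then
these components are disjoint", p. 2355 — here for ANY two distinct vertices of one slab, the
component of `x` being sealed): if `x ≠ y`, neither lies a long edge below the other
(`Δ w(y) < w(x)`, `Δ w(x) < w(y)`), `β < w(y)`, and the component of `x` above `β` is sealed,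
then the box components of `x` and `y` above `β` are disjoint.
[cite: Timar2006, §4 (proof of Thm. 4.3: good components of distinct vertices are disjoint)] -/
theorem timarBoxCluster_disjoint {x y : V} (hxy : x ≠ y)
    (hyx : minNbrWeight G o * autWeight G o y < autWeight G o x)
    (hxy' : minNbrWeight G o * autWeight G o x < autWeight G o y) {ρ ρ' : ℕ} {β : ℝ≥0∞}
    (hy : β < autWeight G o y) {ω : BondConfig V} (hseal : TimarSealed G o x ρ β ω) :
    Disjoint (timarBoxCluster G o x ρ β ω) (timarBoxCluster G o y ρ' β ω) := by
  rw [Set.disjoint_left]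
  intro v hvx hvy
  have hx : x ∉ timarBox G o y ρ' β := not_mem_timarBox_of_lt hxy hyx ρ' β
  -- an open box-`y` walk from `v` back to `y` stays in the component of `x`, so `y ∈ K_x ⊆ B_x`
  rw [timarBoxCluster, mem_openClusterIn_iff] at hvy
  obtain ⟨p⟩ := hvy.symm
  have hyK := mem_timarBoxCluster_of_boxGraph_walk hseal hx hy p hvx
  exact not_mem_timarBox_of_lt (Ne.symm hxy) hxy' ρ β (timarBoxCluster_subset_timarBox x ρ β ω hyK)

/-- Within one slab `G(ℓ_{b+1}, ℓ_b]` no vertex is a long edge below another: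
`Δ w(y) < w(x)` for `x, y ∈ slab b`. [folklore] -/
theorem mul_lt_of_mem_slab {b : ℕ} {x y : V} (hx : x ∈ slab G o b) (hy : y ∈ slab G o b) :
    minNbrWeight G o * autWeight G o y < autWeight G o x :=
  calc minNbrWeight G o * autWeight G o y ≤ minNbrWeight G o * minNbrWeight G o ^ b := by
        gcongr; exact hy.2
    _ = minNbrWeight G o ^ (b + 1) := by ring
    _ < autWeight G o x := hx.1

/-! ### Children of a generation -/

/-- The bottom of the boxes of generation `b` (boxes of depth `n + 2` slabs below the slab `b`):
`β_b = Δ^{b+n+3}`. [cite: Timar2006, §4 (proof of Thm. 4.3: B_x = B_x(i; r) for x ∈ G(ℓ_{gi+1}, ℓ_{gi}])] -/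
def timarBottom (G : SimpleGraph V) [G.LocallyFinite] (o : V) (b n : ℕ) : ℝ≥0∞ :=
  minNbrWeight G o ^ (b + n + 3)

/-- The **children** of a vertex `x` of slab `b`: if its box component (radius `ρ`, bottom
`Δ^{b+n+3}`) is sealed, the vertices of the component in the lowest slab `G(ℓ_{b+n+3}, ℓ_{b+n+2}]`
of the box; otherwise none ("If the open component of `o` in `B_o` is good … For each of these
vertices `x`, add a child `x̂` to `ô` in `T` … If the component of `o` in `B_o` is not good, let
`ô` have 0 children", p. 2354). [cite: Timar2006, §4 (proof of Thm. 4.3: the generations of T)] -/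
def timarChildren (G : SimpleGraph V) [G.LocallyFinite] (o : V) (b n ρ : ℕ) (x : V)
    (ω : BondConfig V) : Set V :=
  {c | x ∈ slab G o b ∧ TimarSealed G o x ρ (timarBottom G o b n) ω ∧
    c ∈ timarBoxCluster G o x ρ (timarBottom G o b n) ω ∧ c ∈ slab G o (b + n + 2)}

/-- Children lie in the box component of their parent. [folklore] -/
theorem timarChildren_subset_timarBoxCluster (b n ρ : ℕ) (x : V) (ω : BondConfig V) :
    timarChildren G o b n ρ x ω ⊆ timarBoxCluster G o x ρ (timarBottom G o b n) ω :=
  fun _ hc => hc.2.2.1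

/-- Children lie in the open cluster of their parent. [cite: Timar2006, §4 (proof of Thm. 4.3: "the corresponding vertices in G all belong to one (infinite) open cluster")] -/
theorem timarChildren_subset_openCluster (b n ρ : ℕ) (x : V) (ω : BondConfig V) :
    timarChildren G o b n ρ x ω ⊆ openCluster ω x :=
  (timarChildren_subset_timarBoxCluster b n ρ x ω).trans (timarBoxCluster_subset_openCluster _ _ _ ω)

/-- Children lie one generation down, in the slab `b + n + 2`. [cite: Timar2006, §4 (proof of Thm. 4.3: O_{g+1} ⊆ G(ℓ_{(g+1)i+1}, ℓ_{(g+1)i}])] -/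
theorem timarChildren_subset_slab (b n ρ : ℕ) (x : V) (ω : BondConfig V) :
    timarChildren G o b n ρ x ω ⊆ slab G o (b + n + 2) :=
  fun _ hc => hc.2.2.2

/-- Only vertices of slab `b` have generation-`b` children. [folklore] -/
theorem mem_slab_of_mem_timarChildren {b n ρ : ℕ} {x c : V} {ω : BondConfig V}
    (h : c ∈ timarChildren G o b n ρ x ω) : x ∈ slab G o b :=
  h.1

/-- Children lie in the ball `B(x, ρ)`. [folklore] -/
theorem timarChildren_subset_graphBall (b n ρ : ℕ) (x : V) (ω : BondConfig V) :
    timarChildren G o b n ρ x ω ⊆ graphBall G x ρ :=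
  (timarChildren_subset_timarBoxCluster b n ρ x ω).trans
    ((timarBoxCluster_subset_timarBox _ _ _ ω).trans (timarBox_subset_graphBall _ _ _))

/-- The children form a finite set. [folklore] -/
theorem timarChildren_finite (b n ρ : ℕ) (x : V) (ω : BondConfig V) :
    (timarChildren G o b n ρ x ω).Finite :=
  (graphBall_finite G x ρ).subset (timarChildren_subset_graphBall b n ρ x ω)

/-- A vertex with children has a sealed box component. [folklore] -/
theorem timarSealed_of_mem_timarChildren {b n ρ : ℕ} {x c : V} {ω : BondConfig V}
    (h : c ∈ timarChildren G o b n ρ x ω) : TimarSealed G o x ρ (timarBottom G o b n) ω :=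
  h.2.1

/-- The bottom of generation `b` lies below the slab `b`: `Δ^{b+n+3} < w(y)` for `y ∈ slab b`.
[folklore] -/
theorem timarBottom_lt_of_mem_slab (hconn : G.Connected) (htr : IsGraphTransitive G)
    (hU : ¬ IsGraphUnimodular G) {b : ℕ} (n : ℕ) {y : V} (hy : y ∈ slab G o b) :
    timarBottom G o b n < autWeight G o y :=
  lt_trans (minNbrWeight_pow_lt_pow hconn htr hU o (by omega)) hy.1

/-- **Children of distinct parents of one generation are disjoint** (the parents' sealed box
components are, `timarBoxCluster_disjoint`). [cite: Timar2006, §4 (proof of Thm. 4.3: "distinct vertices in T correspond to distinct vertices in C(o)")] -/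
theorem timarChildren_disjoint (hconn : G.Connected) (htr : IsGraphTransitive G)
    (hU : ¬ IsGraphUnimodular G) {b : ℕ} (n ρ : ℕ) {x y : V} (hxy : x ≠ y) (ω : BondConfig V) :
    Disjoint (timarChildren G o b n ρ x ω) (timarChildren G o b n ρ y ω) := by
  rw [Set.disjoint_left]
  intro c hcx hcy
  exact Set.disjoint_left.1 (timarBoxCluster_disjoint hxy (mul_lt_of_mem_slab hcx.1 hcy.1)
    (mul_lt_of_mem_slab hcy.1 hcx.1) (timarBottom_lt_of_mem_slab hconn htr hU n hcy.1) hcx.2.1)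
    hcx.2.2.1 hcy.2.2.1

/-! ### The good event of a vertex and the offspring bound -/

/-- `y` carries an **open long edge downwards**: an open edge of `G` to a vertex of weight
`Δ · w(y)`. [cite: Timar2006, §4 (proof of Thm. 4.3: long edges)] -/
def TimarSteepOpen (G : SimpleGraph V) [G.LocallyFinite] (o y : V) (ω : BondConfig V) : Prop :=
  ∃ u : V, G.Adj y u ∧ autWeight G o u = minNbrWeight G o * autWeight G o y ∧ s(y, u) ∈ ω

/-- The vertices counted by the good event of `x` (depth `n`, radius `ρ`): vertices of the box
component of `x` above the RELATIVE bottom `Δ^{n+2} w(x)`, of weight at most `Δ^{n+1} w(x)`, with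
an open long edge downwards. [cite: Timar2006, §4 (proof of Thm. 4.3: "at least k vertices in G(ℓ_{j+i}, ℓ_{j+i-1}]")] -/
def timarCountSet (G : SimpleGraph V) [G.LocallyFinite] (o : V) (n ρ : ℕ) (x : V)
    (ω : BondConfig V) : Set V :=
  {y | y ∈ timarBoxCluster G o x ρ (minNbrWeight G o ^ (n + 2) * autWeight G o x) ω ∧
    autWeight G o y ≤ minNbrWeight G o ^ (n + 1) * autWeight G o x ∧ TimarSteepOpen G o y ω}

/-- The **good event** of `x` (depth `n`, radius `r`, count `k`): the box component of `x` of
radius `r + 1` above the relative bottom `Δ^{n+3} w(x)` is sealed, and at least `k` vertices are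
counted by `timarCountSet G o n r x`. It is `x`-relative (hence has the same probability for all
`x`, by automorphism invariance) and local.
[cite: Timar2006, §4 (proof of Thm. 4.3: the component of x in B_x(i; r) is good)] -/
def timarGood (G : SimpleGraph V) [G.LocallyFinite] (o : V) (n r k : ℕ) (x : V) :
    Set (BondConfig V) :=
  {ω | TimarSealed G o x (r + 1) (minNbrWeight G o ^ (n + 3) * autWeight G o x) ω ∧
    (k : ℕ∞) ≤ (timarCountSet G o n r x ω).encard}

/-- A vertex lies in at most one slab: the slab index is a function of the vertex. [folklore] -/
theorem slab_index_unique (hconn : G.Connected) (htr : IsGraphTransitive G)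
    (hU : ¬ IsGraphUnimodular G) {i j : ℕ} {v : V} (hi : v ∈ slab G o i)
    (hj : v ∈ slab G o j) : i = j := by
  by_contra h
  exact Set.disjoint_left.1 (slab_disjoint hconn htr hU o h) hi hj

/-! ### Regions of edges read by a generation; the mass process -/

/-- The edges of `G` inside the ball `B(x, R)` (both endpoints in the ball): the finite set
of edges a box of radius `R - 1` around `x` and its sealing condition depend on. [folklore] -/
def ballEdgeSet (G : SimpleGraph V) [G.LocallyFinite] (x : V) (R : ℕ) : Set (Sym2 V) :=
  {e | e ∈ G.edgeSet ∧ ∀ u ∈ e, u ∈ graphBall G x R}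

/-- `ballEdgeSet` is finite (it embeds into `B(x, R) × B(x, R)`). [folklore] -/
theorem ballEdgeSet_finite (x : V) (R : ℕ) : (ballEdgeSet G x R).Finite := by
  refine ((graphBall_finite G x R).prod (graphBall_finite G x R)).image
    (fun q : V × V => s(q.1, q.2)) |>.subset ?_
  intro e he
  induction e using Sym2.ind with
  | h u v => exact ⟨(u, v), ⟨he.2 u (Sym2.mem_mk_left u v), he.2 v (Sym2.mem_mk_right u v)⟩, rfl⟩


/-- The **region** of generation `b` (depth `n`): the edges of `G` with both endpoints strictly
above the bottom `Δ^{b+n+3}` and some endpoint of weight `≤ Δ^{b+1}` — every edge read by the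
generation-`b` boxes and their sealing conditions; the regions of the generations `0, n+2,
2(n+2), …` are pairwise disjoint ("the edge sets in `B_x` and `B_y` are disjoint whenever …
`g ≠ g′`", p. 2355). [cite: Timar2006, §4 (proof of Thm. 4.3: edge sets of different generations are disjoint)] -/
def timarRegion (G : SimpleGraph V) [G.LocallyFinite] (o : V) (b n : ℕ) : Set (Sym2 V) :=
  {e | e ∈ G.edgeSet ∧ (∀ u ∈ e, timarBottom G o b n < autWeight G o u) ∧
    ∃ u ∈ e, autWeight G o u ≤ minNbrWeight G o ^ (b + 1)}

/-- The **mass process** of the branching construction: generation `g` lives in the slab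
`g (n + 2)`; `m_0 = 1_{o}` and a child `c` of a generation-`g` vertex `x` inherits the mass
`m_g(x) · θ_g(x)` ("`O_{g+1}` = the children of the vertices of `O_g`", p. 2354; the weights
`θ` — in the proof, the inverse mean offspring numbers — replace the thinning to "exactly `k`
children with probability `p`" of the proof of Lemma 4.1, p. 2352, and make the total mass a
martingale). The support of `m_g` is the generation `O_g ⊆ C(o)`.
[cite: Timar2006, §4 (proof of Thm. 4.3: the generations O_g of T; proof of Lemma 4.1: Y_m = |O_m|/(pk)^m)] -/
def timarMass (G : SimpleGraph V) [G.LocallyFinite] (o : V) (n ρ : ℕ) (θ : ℕ → V → ℝ≥0∞)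
    (ω : BondConfig V) : ℕ → V → ℝ≥0∞
  | 0 => ({o} : Set V).indicator 1
  | g + 1 => fun c => ∑' x, timarMass G o n ρ θ ω g x * θ g x *
      (timarChildren G o (g * (n + 2)) n ρ x ω).indicator 1 c

/-- The **total mass** `Y_g = Σ_c m_g(c)` of generation `g` (the martingale replacing
`Y_m = |O_m|/(pk)^m` of the proof of Lemma 4.1); `Y_g ≠ 0` iff generation `g` is nonempty.
[cite: Timar2006, §4 (proof of Lemma 4.1: the martingale Y_m)] -/
def timarPop (G : SimpleGraph V) [G.LocallyFinite] (o : V) (n ρ : ℕ) (θ : ℕ → V → ℝ≥0∞)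
    (ω : BondConfig V) (g : ℕ) : ℝ≥0∞ :=
  ∑' c, timarMass G o n ρ θ ω g c

/-- The mass recursion, unfolded. [folklore] -/
theorem timarMass_succ (n ρ : ℕ) (θ : ℕ → V → ℝ≥0∞) (ω : BondConfig V) (g : ℕ) (c : V) :
    timarMass G o n ρ θ ω (g + 1) c = ∑' x, timarMass G o n ρ θ ω g x * θ g x *
      (timarChildren G o (g * (n + 2)) n ρ x ω).indicator 1 c :=
  rfl

/-- Generation `0` is the unit mass at `o`. [folklore] -/
theorem timarMass_zero (n ρ : ℕ) (θ : ℕ → V → ℝ≥0∞) (ω : BondConfig V) :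
    timarMass G o n ρ θ ω 0 = ({o} : Set V).indicator 1 :=
  rfl

end Box

end Literature.Barriers.CriticalPhenomena

end
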